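import Literature.MathematicalPhysics.QuantumFieldTheory.Balaban1983to89.B9Eq327GreenZdHerm
import Literature.MathematicalPhysics.QuantumFieldTheory.Balaban1983to89.B9Eq342CombesThomasFormZd
import Literature.MathematicalPhysics.QuantumFieldTheory.Balaban1983to89.B9Eq349KernelCompositionZd

/-!
# `Balaban1983to89.B9Eq342GreenHermOperatorDecayZd` — [Balaban1985BackgroundPropagators] (3.42) p. 397 (the `n = 0` member «|(G(U)λ)(x)| ≤ B₀ Σ e^{−δ₀|x−x′|}…»
# as Thm 3.3 p. 399 states it for `G(U)`) and (3.27) p. 395: FOR THE HERMITIAN GREEN OPERATOR `G_𝔤(U₀) = (Ω₀Δ_a(U₀)Ω₀)⁻¹` OF ANY LETTER RECORD AT A FINITE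
# `Ω₀`, a KERNEL bound `|(G_𝔤(U₀)δ_{b′}w)(b)|_τ ≤ C·e^{−κ|b−b′|_∞}·|w|_τ` (dag-n06-w2's Combes–Thomas road, this seat's `B9Thm311KernelDecayTouchingCubeZd`) IS the
# OPERATOR bound `|(G_𝔤(U₀)J)(b)|_τ ≤ Σ_{b′} C·e^{−κ|b−b′|_∞}·|J(b′)|_τ` on `E_𝔤(Ω₀)`, and its sup form `≤ C·d·K_d(κ)·sup|J|_τ` — the bond ∕ Hermitian twin of
# dag-n06-w2's site-operator lemma `B9Thm33GDecayOfCoerciveZd.fnorm_GpZd_le_of_decay`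

statement-level skeleton of published theorems with citation tags; proofs where landed; nothing here is a claim about the
Yang–Mills mass gap

`[Balaban1985BackgroundPropagators]` ("B9", CMP **99** (1985) 389–434): (3.42) p. 397 (the form of the estimates: kernel-type bounds `B₀ e^{−δ₀ dist}` applied to
the input), Thm 3.3 p. 399 («the inequalities (3.42)–(3.47) hold for … G′(U) replaced by G(U)»), (3.27) p. 395; [Balaban1985RegularSpaces] (1.58)–(1.59) p. 86 (how
[B8] reads Thm 3.3: bounds of `G(U₀)J` for `J` on the bonds of `Ω₀`).  HERE: bookkeeping — a bond field on `E(Ω₀)` is the finite sum of its single-bond bumps, `G_𝔤`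
is additive, the fibre size is subadditive; the row sum of `e^{−κ|·|_∞}` over the bonds touching a finite `Ω₀` is at most `d·K_d(κ)`.

CITATION HEADER (lean-in-tree rule).  Cell `pub-ymgap` (YM Track A, HUMAN RULING D-0062 ∕ D-0149), DAG node N06 = [B9], seat `pub-ymgap-dag-n06-b` (g21; junction ∕
letter lineage), CLAIM-3 part (a) (the record-free half; part (b), the cube-member corollaries over `B9Thm311KernelDecayTouchingCubeZd`, files when that
module's olean is served).  Inputs BY NAME: dag-n06-w4's `B9Eq327GreenZd.{domSub, setOf_bondTouches_finite}`, this seat's `B9Eq327GreenZdHerm.{domSubH, gopZdH,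
gopZdH_add}`; dag-n06-w2's `B9Eq342CombesThomasFormZd.{fnorm, fnorm_sum_le}`, `B9Eq349KernelCompositionZd.sum_exp_neg_mul_linfDist_le`; `B7Prop5Flat.bump`.
Nothing restated.

WHAT IS PROVED (kernel, 0 sorry, 0 def; any record `o : OpsZd`, any finite `Ω₀`).
* `eq_sum_bump_of_mem_domSub` (a field of `E(Ω₀)` is the sum of its bumps over the bonds touching `Ω₀`), `gopZdH_zero`, `gopZdH_sum` (`G_𝔤` of a finite sum);
* ★★ `fnorm_gopZdH_apply_le_sum_of_kernelDecay` — KERNEL bound ⟹ OPERATOR bound `|(G_𝔤(U₀)J)(b)|_τ ≤ Σ_{b′ touching Ω₀} C e^{−κ|b−b′|_∞}|J(b′)|_τ` for every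
  `J ∈ E_𝔤(Ω₀)` and `b` touching `Ω₀` (faithful Hermitian `τ`);
* `sum_exp_bonds_le` (`Σ_{b′ touching Ω₀} e^{−κ|x−b′|_∞} ≤ d·K_d(κ)`, `K_d(κ) = 3ᵈ·d!·(2∕κ)ᵈ·e^{κ∕2}∕(1 − e^{−κ∕2})`);
* ★★ `fnorm_gopZdH_apply_le_sup_of_kernelDecay` — the sup form `≤ C·d·K_d(κ)·S` when `|J(b′)|_τ ≤ S` (`C ≥ 0`, `κ > 0`, `S ≥ 0`).

HONEST SCOPE.  Count-neutral helper; pure bookkeeping (no estimate of [B9]); the kernel bound is the DISPLAYED input (a theorem per cube member and per datum by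
`B9Thm311KernelDecayTouchingCubeZd.exists_kernelDecay_of_inAk_cube`, constants member-dependent); the fibre size `|·|_τ` is used, not the operator norm; N05 ∕ N06 NOT
discharged; K1⁹ `stmt-QuantumFields-27364` NOT closed; one finite `𝕋⁴` programme at fixed `ε`, Bałaban as printed; R4 closes only the conditional finite-`𝕋⁴` rung
`BalabanLadder.UV` — nothing continuum ∕ ℝ⁴ ∕ OS ∕ mass gap ∕ Clay.  Unit `pub-ymgap-dag-n06-b` (g21), 2026-08-28.
-/

noncomputable section

open scoped BigOperators Nat

namespace Literature.MathematicalPhysics.QuantumFieldTheory.Balaban1983to89.B9Eq342GreenHermOperatorDecayZd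

open B7Prop5Flat (bump)
open B8Ineq132 (BondTouches)
open B9SupplySockB9P3ZdLetters (OpsZd)
open B9Eq327GreenZd (domSub setOf_bondTouches_finite)
open B9Eq327GreenZdHerm (domSubH gopZdH gopZdH_add)
open B9Eq342CombesThomasFormZd (fnorm fnorm_nonneg fnorm_sum_le)
open B9Eq349KernelCompositionZd (sum_exp_neg_mul_linfDist_le)
open LatticeNorms (linfDist)

-- `Site` alone could resolve to the torus sites of `Setup.lean`; re-export the `ℤ^d` sites of `B7Prop1Explicit`.
export B7Prop1Explicit (Site)

variable {d : ℕ} {𝔸 : Type*} [CStarAlgebra 𝔸]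

/-! ## §1 From the kernel bound to the operator bound (any record, any finite `Ω₀`) -/

section Operator

variable (τ : 𝔸 →ₗ[ℂ] ℂ)

/-- **A FIELD OF `E(Ω₀)` IS THE SUM OF ITS BUMPS** over the (finitely many) bonds touching the finite `Ω₀`.
[cite: Balaban1985BackgroundPropagators, (3.27) p.395; Balaban1985RegularSpaces, p.77 (bond convention; bookkeeping)] -/
theorem eq_sum_bump_of_mem_domSub {Ω₀ : Set (Site d)} (hΩ : Ω₀.Finite) {J : Site d → Fin d → 𝔸} (hJ : J ∈ domSub (𝔸 := 𝔸) Ω₀) :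
    J = ∑ b' ∈ (setOf_bondTouches_finite hΩ).toFinset, bump b'.1 b'.2 (J b'.1 b'.2) := by
  classical
  funext y τ'
  rw [Finset.sum_apply, Finset.sum_apply]
  have hterm : ∀ b' ∈ (setOf_bondTouches_finite hΩ).toFinset,
      bump b'.1 b'.2 (J b'.1 b'.2) y τ' = if b' = (y, τ') then J y τ' else 0 := by
    intro b' _
    unfold bump
    by_cases h : b' = (y, τ')
    · subst h; simp
    · rw [if_neg h, if_neg]
      rintro ⟨h1, h2⟩
      exact h (Prod.ext h1.symm h2.symm)
  rw [Finset.sum_congr rfl hterm, Finset.sum_ite_eq']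
  split_ifs with hmem
  · rfl
  · rw [Set.Finite.mem_toFinset] at hmem
    exact hJ y τ' hmem

/-- `G_𝔤(U₀)0 = 0`. [cite: Balaban1985BackgroundPropagators, (3.27) p.395 (bookkeeping)] -/
theorem gopZdH_zero (η : ℝ) (o : OpsZd d 𝔸) (Ω₀ : Set (Site d)) (U₀ : Site d → Fin d → 𝔸ˣ) :
    gopZdH η o Ω₀ U₀ (0 : Site d → Fin d → 𝔸) = 0 := by
  have h := gopZdH_add η o Ω₀ U₀ (0 : Site d → Fin d → 𝔸) 0
  rw [add_zero] at h
  exact left_eq_add.mp h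

/-- **`G_𝔤` OF A FINITE SUM IS THE SUM** (additivity, `gopZdH_add`). [cite: Balaban1985BackgroundPropagators, (3.27) p.395] -/
theorem gopZdH_sum (η : ℝ) (o : OpsZd d 𝔸) (Ω₀ : Set (Site d)) (U₀ : Site d → Fin d → 𝔸ˣ) {ι : Type*} (s : Finset ι)
    (F : ι → Site d → Fin d → 𝔸) : gopZdH η o Ω₀ U₀ (∑ i ∈ s, F i) = ∑ i ∈ s, gopZdH η o Ω₀ U₀ (F i) := by
  classical
  induction s using Finset.induction_on with
  | empty => rw [Finset.sum_empty, Finset.sum_empty, gopZdH_zero]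
  | insert i s hi ih => rw [Finset.sum_insert hi, Finset.sum_insert hi, gopZdH_add, ih]

/-- ★★ **FROM THE KERNEL BOUND TO THE OPERATOR BOUND** (any record `o`, finite `Ω₀`, faithful Hermitian `τ`): if `|(G_𝔤(U₀)δ_{b′}w)(b)|_τ ≤ C·e^{−κ|b−b′|_∞}·|w|_τ`
for the bonds `b, b′` touching `Ω₀` and Hermitian `w`, then for every `J ∈ E_𝔤(Ω₀)` and every bond `b` touching `Ω₀`:
`|(G_𝔤(U₀)J)(b)|_τ ≤ Σ_{b′ touching Ω₀} C·e^{−κ|b−b′|_∞}·|J(b′)|_τ` — the `n = 0` member of (3.42) in the fibre size.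
[cite: Balaban1985BackgroundPropagators, (3.42) p.397, Thm 3.3 p.399, (3.27) p.395; Balaban1985RegularSpaces, (1.58)–(1.59) p.86] -/
theorem fnorm_gopZdH_apply_le_sum_of_kernelDecay (hτp : ∀ a : 𝔸, a ≠ 0 → 0 < (τ (star a * a)).re)
    (hτs : ∀ a : 𝔸, τ (star a) = starRingEnd ℂ (τ a)) (η : ℝ) (o : OpsZd d 𝔸) {Ω₀ : Set (Site d)} (hΩ : Ω₀.Finite)
    (U₀ : Site d → Fin d → 𝔸ˣ) {C κ : ℝ}
    (hP : ∀ b b' : Site d × Fin d, BondTouches Ω₀ b.1 b.2 → BondTouches Ω₀ b'.1 b'.2 → ∀ w : 𝔸, IsSelfAdjoint w →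
      fnorm τ (gopZdH η o Ω₀ U₀ (bump b'.1 b'.2 w) b.1 b.2) ≤ C * Real.exp (-(κ * (linfDist b.1 b'.1 : ℝ))) * fnorm τ w)
    {J : Site d → Fin d → 𝔸} (hJ : J ∈ domSubH (𝔸 := 𝔸) Ω₀) (b : Site d × Fin d) (hb : BondTouches Ω₀ b.1 b.2) :
    fnorm τ (gopZdH η o Ω₀ U₀ J b.1 b.2) ≤
      ∑ b' ∈ (setOf_bondTouches_finite hΩ).toFinset, C * Real.exp (-(κ * (linfDist b.1 b'.1 : ℝ))) * fnorm τ (J b'.1 b'.2) := by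
  classical
  have hdec : gopZdH η o Ω₀ U₀ J b.1 b.2 =
      ∑ b' ∈ (setOf_bondTouches_finite hΩ).toFinset, gopZdH η o Ω₀ U₀ (bump b'.1 b'.2 (J b'.1 b'.2)) b.1 b.2 := by
    conv_lhs => rw [eq_sum_bump_of_mem_domSub hΩ hJ.1]
    rw [gopZdH_sum, Finset.sum_apply, Finset.sum_apply]
  rw [hdec]
  refine (fnorm_sum_le hτp hτs _ _).trans (Finset.sum_le_sum fun b' hb' => ?_)
  rw [Set.Finite.mem_toFinset] at hb'
  exact hP b b' hb hb' (J b'.1 b'.2) (hJ.2 b'.1 b'.2)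

omit [CStarAlgebra 𝔸] in
/-- **THE ROW SUM OVER THE BONDS TOUCHING A FINITE `Ω₀`**: `Σ_{b′} e^{−κ|x−b′|_∞} ≤ d·K_d(κ)`, `K_d(κ) = 3ᵈ·d!·(2∕κ)ᵈ·e^{κ∕2}∕(1 − e^{−κ∕2})` (at most `d` bonds over a
site; dag-n06-w2's `sum_exp_neg_mul_linfDist_le` over the base points). [cite: Balaban1985BackgroundPropagators, (3.42) p.397, (3.107)–(3.108) pp.415–416 (bookkeeping)] -/
theorem sum_exp_bonds_le {Ω₀ : Set (Site d)} (hΩ : Ω₀.Finite) {κ : ℝ} (hκ : 0 < κ) (x : Site d) :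
    ∑ b' ∈ (setOf_bondTouches_finite hΩ).toFinset, Real.exp (-(κ * (linfDist x b'.1 : ℝ))) ≤
      d * ((3 : ℝ) ^ d * (d ! : ℝ) * (2 / κ) ^ d * Real.exp (κ / 2) / (1 - Real.exp (-(κ / 2)))) := by
  classical
  set T := (setOf_bondTouches_finite hΩ).toFinset with hT
  have hsub : T ⊆ (T.image Prod.fst) ×ˢ (Finset.univ : Finset (Fin d)) := by
    intro b hb
    rw [Finset.mem_product]
    exact ⟨Finset.mem_image_of_mem _ hb, Finset.mem_univ _⟩
  calc ∑ b' ∈ T, Real.exp (-(κ * (linfDist x b'.1 : ℝ)))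
      ≤ ∑ b' ∈ (T.image Prod.fst) ×ˢ (Finset.univ : Finset (Fin d)), Real.exp (-(κ * (linfDist x b'.1 : ℝ))) :=
        Finset.sum_le_sum_of_subset_of_nonneg hsub fun _ _ _ => (Real.exp_pos _).le
    _ = ∑ z ∈ T.image Prod.fst, ∑ _μ : Fin d, Real.exp (-(κ * (linfDist x z : ℝ))) := Finset.sum_product _ _ _
    _ = d * ∑ z ∈ T.image Prod.fst, Real.exp (-(κ * (linfDist x z : ℝ))) := by
        rw [Finset.mul_sum]
        refine Finset.sum_congr rfl fun z _ => ?_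
        rw [Finset.sum_const, Finset.card_univ, Fintype.card_fin, nsmul_eq_mul]
    _ ≤ d * ((3 : ℝ) ^ d * (d ! : ℝ) * (2 / κ) ^ d * Real.exp (κ / 2) / (1 - Real.exp (-(κ / 2)))) :=
        mul_le_mul_of_nonneg_left (sum_exp_neg_mul_linfDist_le hκ _ x) (Nat.cast_nonneg d)

/-- ★★ **THE SUP FORM**: under the kernel bound (`C ≥ 0`, `κ > 0`), for `J ∈ E_𝔤(Ω₀)` with `|J(b′)|_τ ≤ S` on the bonds touching `Ω₀` (`S ≥ 0`) and `b` touching `Ω₀`: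
`|(G_𝔤(U₀)J)(b)|_τ ≤ C·d·K_d(κ)·S` — the sup-norm reading [B8] (1.59) makes of Thm 3.3, in the fibre size.
[cite: Balaban1985BackgroundPropagators, (3.42) p.397, Thm 3.3 p.399; Balaban1985RegularSpaces, (1.58)–(1.59) p.86] -/
theorem fnorm_gopZdH_apply_le_sup_of_kernelDecay (hτp : ∀ a : 𝔸, a ≠ 0 → 0 < (τ (star a * a)).re)
    (hτs : ∀ a : 𝔸, τ (star a) = starRingEnd ℂ (τ a)) (η : ℝ) (o : OpsZd d 𝔸) {Ω₀ : Set (Site d)} (hΩ : Ω₀.Finite)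
    (U₀ : Site d → Fin d → 𝔸ˣ) {C κ : ℝ} (hC : 0 ≤ C) (hκ : 0 < κ)
    (hP : ∀ b b' : Site d × Fin d, BondTouches Ω₀ b.1 b.2 → BondTouches Ω₀ b'.1 b'.2 → ∀ w : 𝔸, IsSelfAdjoint w →
      fnorm τ (gopZdH η o Ω₀ U₀ (bump b'.1 b'.2 w) b.1 b.2) ≤ C * Real.exp (-(κ * (linfDist b.1 b'.1 : ℝ))) * fnorm τ w)
    {J : Site d → Fin d → 𝔸} (hJ : J ∈ domSubH (𝔸 := 𝔸) Ω₀) {S : ℝ} (hS0 : 0 ≤ S)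
    (hS : ∀ b' : Site d × Fin d, BondTouches Ω₀ b'.1 b'.2 → fnorm τ (J b'.1 b'.2) ≤ S) (b : Site d × Fin d) (hb : BondTouches Ω₀ b.1 b.2) :
    fnorm τ (gopZdH η o Ω₀ U₀ J b.1 b.2) ≤
      C * (d * ((3 : ℝ) ^ d * (d ! : ℝ) * (2 / κ) ^ d * Real.exp (κ / 2) / (1 - Real.exp (-(κ / 2))))) * S := by
  classical
  refine (fnorm_gopZdH_apply_le_sum_of_kernelDecay τ hτp hτs η o hΩ U₀ hP hJ b hb).trans ?_
  have hterm : ∀ b' ∈ (setOf_bondTouches_finite hΩ).toFinset,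
      C * Real.exp (-(κ * (linfDist b.1 b'.1 : ℝ))) * fnorm τ (J b'.1 b'.2) ≤ C * Real.exp (-(κ * (linfDist b.1 b'.1 : ℝ))) * S := by
    intro b' hb'
    rw [Set.Finite.mem_toFinset] at hb'
    exact mul_le_mul_of_nonneg_left (hS b' hb') (mul_nonneg hC (Real.exp_pos _).le)
  refine (Finset.sum_le_sum hterm).trans ?_
  rw [← Finset.sum_mul, ← Finset.mul_sum]
  exact mul_le_mul_of_nonneg_right (mul_le_mul_of_nonneg_left (sum_exp_bonds_le hΩ hκ b.1) hC) hS0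

end Operator

end Literature.MathematicalPhysics.QuantumFieldTheory.Balaban1983to89.B9Eq342GreenHermOperatorDecayZd

end
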